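import Literature.Topology.FourManifolds.KhCurlHomotopyPos
import HarnessLib

/-!
# Invariance of Khovanov homology under a negative curl (first Reidemeister move, `ε = -1`)

Sibling file of `KhComplex.lean`, companion of `KhCurlHomotopyPos`, in the invariance programme
for `Literature.Topology.FourManifolds.GaussDiagram.nonempty_iso_khovanovHomology_of_equiv`
(Khovanov (2000), Thm. 1). For every Gauss diagram `G` and the negative curl `G.curl tf (-1)`
(`KhCurlArcs`: the target of `PolyakMove.omega1a/omega1b` with `ε = -1` at the last position):

* `nonempty_iso_khovanovHomology_curl_neg_one : Kh^{i,j}(G) ≅ Kh^{i,j}(G.curl tf (-1))`,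
* `nonempty_iso_frobeniusHomology_curl_neg_one : H^i(G; h, t) ≅ H^i(G.curl tf (-1); h, t)`.

Here `C(D') = C(D) ⊕ (C(D) ⊗ A)` (generators `curlThruES s`, curl `0`-smoothed, and
`curlLoopES s x`, curl `1`-smoothed à la Seifert) with curl edge `Φ = ±Δ` (`KhCurlIncidence`);
the `X`-component of `Δ` is the identity (`coactCoeff_true`), so `C(D)` cancels against
`C(D) ⊗ X`, leaving the subcomplex `C(D) ⊗ 1 ≅ C(D)` (Khovanov (2000), §5.1; Bar-Natan (2002), §4):

* `curlNegF` — the inclusion `s ↦ s ⊗ 1` (a chain map: the curl edge never reaches `(-) ⊗ 1`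
  from `(-) ⊗ 1`, and old chords act alike);
* `curlNegB` — `B(u' ⊗ 1) = u'`, `B(u ⊗ X) = -Δ₁(u)` (the `1`-component of the comultiplication
  at the base arc, `coactCoeff false` of `KhActCoeff`), `B(thru) = 0`; a chain map by
  `sum_coactCoeff_mul_incidence` (**the `1`-component of `Δ` at the base arc commutes with the
  differential**, from the vanishing mixed square of the negative curl, `KhCurlMixedSq`);
* `curlNegH` — `H(thru u) = -(-1)^{|u|} (u ⊗ X)`;
* `B F = 1`, `F B - 1 = d H + H d`, and the degree bookkeeping.

No planarity, no `d² = 0`, no named fact.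

## References

* M. Khovanov, *A categorification of the Jones polynomial*, Duke Math. J. 101 (2000) 359–426,
  §5.1 (left-twisted curl). [cite: Khovanov2000, §5.1]
* D. Bar-Natan, *On Khovanov's categorification of the Jones polynomial*, Algebr. Geom. Topol. 2
  (2002) 337–370, §4. [cite: BarNatan2002, §4]
-/

open Function Finset

noncomputable section

namespace Literature.Topology.FourManifolds

namespace GaussDiagram

variable {G : GaussDiagram} (tf : Bool) {R : Type} [CommRing R]

/-! ## The total differential of the curled diagram, `ε = -1` -/

section NegD

variable (h t : R)

/-- The total differential of the negative curl at `u ⊗ X`: the old differential and the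
`X`-component of the curl edge, which is `(-1)^{|u|}` times the identity. [folklore] -/
theorem totalD_curl_neg_one_loop_true (v : (G.curl tf (-1)).EnhancedState → R) (u : G.EnhancedState) :
    (G.curl tf (-1)).totalD R h t v (curlLoopES tf (-1) u true) =
      ∑ s, G.incidence R h t s u * v (curlLoopES tf (-1) s true) +
        (-1) ^ u.state.weight * v (curlThruES tf (-1) u) := by
  rw [totalD_apply, sum_curlES]
  simp only [incidence_curlLoopES_curlLoopES, Bool.false_eq_true, ↓reduceIte, zero_mul, zero_add,
    G.incidence_curlThruES_curlLoopES tf (-1) R rfl, coactCoeff_true]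
  congr 1
  rw [Finset.sum_eq_single u]
  · simp
  · intro s _ hs
    rw [if_neg (Ne.symm hs)]; ring
  · intro hu; exact absurd (Finset.mem_univ u) hu

/-- The total differential of the negative curl at `u ⊗ 1`: the old differential and the
`1`-component of the comultiplication at the base arc. [folklore] -/
theorem totalD_curl_neg_one_loop_false (v : (G.curl tf (-1)).EnhancedState → R) (u : G.EnhancedState) :
    (G.curl tf (-1)).totalD R h t v (curlLoopES tf (-1) u false) =
      ∑ s, G.incidence R h t s u * v (curlLoopES tf (-1) s false) +
        ∑ s, (-1) ^ s.state.weight * coactCoeff R h t G.baseArc false s u * v (curlThruES tf (-1) s) := by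
  rw [totalD_apply, sum_curlES]
  simp only [incidence_curlLoopES_curlLoopES, ↓reduceIte, Bool.true_eq_false, zero_mul, add_zero,
    G.incidence_curlThruES_curlLoopES tf (-1) R rfl]

/-- The total differential of the negative curl at the `0`-smoothed curl: only the old
differential. [folklore] -/
theorem totalD_curl_neg_one_thru (v : (G.curl tf (-1)).EnhancedState → R) (u : G.EnhancedState) :
    (G.curl tf (-1)).totalD R h t v (curlThruES tf (-1) u) =
      ∑ s, G.incidence R h t s u * v (curlThruES tf (-1) s) := by
  rw [totalD_apply, sum_curlES]
  simp only [G.incidence_curlLoopES_curlThruES_of_eq_neg_one tf (-1) R rfl, zero_mul, add_zero,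
    Finset.sum_const_zero, zero_add, incidence_curlThruES_curlThruES]

end NegD

/-! ## The `1`-component of the comultiplication at the base arc commutes with the differential -/

/-- **The `1`-component of `Δ` on the circle of the base arc is a chain map**:
`∑_t coactCoeff(1; s → t) ⟨d t, u⟩ = ∑_t ⟨d s, t⟩ coactCoeff(1; t → u)` for all enhanced states of
any Gauss diagram — the vanishing of the mixed square of the negative curl
(`sum_incidence_mul_incidence_curl_eq_zero` for `G.curl tf (-1)`, between `thru s` and `u ⊗ 1`).
Khovanov (2000), §5.1; Khovanov (2006), §2. [cite: Khovanov2000, §5.1] -/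
theorem sum_coactCoeff_mul_incidence (h t : R) (s u : G.EnhancedState) :
    ∑ t', coactCoeff R h t G.baseArc false s t' * G.incidence R h t t' u =
      ∑ t', G.incidence R h t s t' * coactCoeff R h t G.baseArc false t' u := by
  have key := G.sum_incidence_mul_incidence_curl_eq_zero true (-1) h t (curlThruES true (-1) s)
    (curlLoopES true (-1) u false) (by simp) (by simp)
  rw [sum_curlES] at key
  simp only [incidence_curlLoopES_curlLoopES, ↓reduceIte, Bool.true_eq_false, mul_zero, add_zero,
    G.incidence_curlThruES_curlLoopES true (-1) R rfl, incidence_curlThruES_curlThruES] at key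
  -- `key : ∑ t', ((-1)^{|s|} C(s → t')) ⟨d t',u⟩ + ∑ t', ⟨d s,t'⟩ ((-1)^{|t'|} C(t' → u)) = 0`
  have h1 : ∑ t', G.incidence R h t s t' * ((-1) ^ t'.state.weight * coactCoeff R h t G.baseArc false t' u) =
      -((-1) ^ s.state.weight * ∑ t', G.incidence R h t s t' * coactCoeff R h t G.baseArc false t' u) := by
    rw [Finset.mul_sum, ← Finset.sum_neg_distrib]
    refine Finset.sum_congr rfl fun t' _ ↦ ?_
    have := negOnePow_weight_mul_incidence h t s t'
    linear_combination (coactCoeff R h t G.baseArc false t' u) * this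
  have h2 : ∑ t', (-1) ^ s.state.weight * coactCoeff R h t G.baseArc false s t' * G.incidence R h t t' u =
      (-1) ^ s.state.weight * ∑ t', coactCoeff R h t G.baseArc false s t' * G.incidence R h t t' u := by
    rw [Finset.mul_sum]
    exact Finset.sum_congr rfl fun t' _ ↦ by ring
  rw [h1, h2] at key
  have h3 := negOnePow_mul_self (R := R) s.state.weight
  linear_combination (-1) ^ s.state.weight * key +
    ((∑ t', G.incidence R h t s t' * coactCoeff R h t G.baseArc false t' u) -
      ∑ t', coactCoeff R h t G.baseArc false s t' * G.incidence R h t t' u) * h3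

/-! ## The homotopy data of the negative curl -/

section Neg

variable (G) (h t : R)

/-- **The chain map `F : C(D) → C(D')` of the negative curl**: the inclusion `s ↦ s ⊗ 1` of the
subcomplex spanned by the `1`-labelled loop states. Khovanov (2000), §5.1; Bar-Natan (2002), §4.
[cite: Khovanov2000, §5.1] -/
def curlNegF : (G.EnhancedState → R) →ₗ[R] ((G.curl tf (-1)).EnhancedState → R) where
  toFun w y := Sum.elim (fun p : G.EnhancedState × Bool ↦ if p.2 then (0 : R) else w p.1)
    (fun _ ↦ (0 : R)) (G.curlESEquiv tf (-1) y)
  map_add' v w := by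
    funext y
    simp only [Pi.add_apply]
    generalize G.curlESEquiv tf (-1) y = z
    rcases z with ⟨u, _ | _⟩ | u <;> simp
  map_smul' c v := by
    funext y
    simp only [Pi.smul_apply, smul_eq_mul, RingHom.id_apply]
    generalize G.curlESEquiv tf (-1) y = z
    rcases z with ⟨u, _ | _⟩ | u <;> simp

/-- **The chain map `B : C(D') → C(D)` of the negative curl**: `B(u ⊗ 1) = u`,
`B(u ⊗ X) = -Δ₁(u)` (the `1`-component of the comultiplication at the base arc), `B(thru) = 0`:
on coefficient functions `(B v)(u') = v(u' ⊗ 1) - ∑ᵤ coactCoeff(1; u → u') v(u ⊗ X)`.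
Khovanov (2000), §5.1; Bar-Natan (2002), §4. [cite: Khovanov2000, §5.1] -/
def curlNegB : ((G.curl tf (-1)).EnhancedState → R) →ₗ[R] (G.EnhancedState → R) where
  toFun v u' := v (curlLoopES tf (-1) u' false) -
    ∑ u, coactCoeff R h t G.baseArc false u u' * v (curlLoopES tf (-1) u true)
  map_add' v w := by
    funext u'
    simp only [Pi.add_apply, mul_add, Finset.sum_add_distrib]
    ring
  map_smul' c v := by
    funext u'
    simp only [Pi.smul_apply, smul_eq_mul, RingHom.id_apply]
    rw [mul_sub, Finset.mul_sum]
    exact congrArg₂ _ rfl (Finset.sum_congr rfl fun u _ ↦ by ring)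

/-- **The homotopy `H : C(D') → C(D')` of the negative curl**: `H(thru u) = -(-1)^{|u|} (u ⊗ X)`
(minus the inverse of the cancelled isomorphism `thru u ↦ (-1)^{|u|} u ⊗ X + …`), zero on the
loop states: on coefficient functions `(H v)(thru u) = -(-1)^{|u|} v(u ⊗ X)`.
Bar-Natan (2002), §4. [cite: BarNatan2002, §4] -/
def curlNegH : ((G.curl tf (-1)).EnhancedState → R) →ₗ[R] ((G.curl tf (-1)).EnhancedState → R) where
  toFun v y := Sum.elim (fun _ : G.EnhancedState × Bool ↦ (0 : R))
    (fun u ↦ -((-1) ^ u.state.weight * v (curlLoopES tf (-1) u true))) (G.curlESEquiv tf (-1) y)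
  map_add' v w := by
    funext y
    simp only [Pi.add_apply]
    generalize G.curlESEquiv tf (-1) y = z
    rcases z with ⟨u, _⟩ | u
    · simp
    · simp only [Sum.elim_inr]; ring
  map_smul' c v := by
    funext y
    simp only [Pi.smul_apply, smul_eq_mul, RingHom.id_apply]
    generalize G.curlESEquiv tf (-1) y = z
    rcases z with ⟨u, _⟩ | u
    · simp
    · simp only [Sum.elim_inr]; ring

variable {G h t}

/-- `F` at `s ⊗ 1`. [folklore] -/
@[simp]
theorem curlNegF_loop_false (w : G.EnhancedState → R) (s : G.EnhancedState) :
    G.curlNegF tf w (curlLoopES tf (-1) s false) = w s := by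
  simp [curlNegF]

/-- `F` at `s ⊗ X`. [folklore] -/
@[simp]
theorem curlNegF_loop_true (w : G.EnhancedState → R) (s : G.EnhancedState) :
    G.curlNegF tf w (curlLoopES tf (-1) s true) = 0 := by
  simp [curlNegF]

/-- `F` at the `0`-smoothed curl. [folklore] -/
@[simp]
theorem curlNegF_thru (w : G.EnhancedState → R) (s : G.EnhancedState) :
    G.curlNegF tf w (curlThruES tf (-1) s) = 0 := by
  simp [curlNegF]

/-- `B`, pointwise. [folklore] -/
@[simp]
theorem curlNegB_apply (v : (G.curl tf (-1)).EnhancedState → R) (u' : G.EnhancedState) :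
    G.curlNegB tf h t v u' = v (curlLoopES tf (-1) u' false) -
      ∑ u, coactCoeff R h t G.baseArc false u u' * v (curlLoopES tf (-1) u true) := rfl

/-- `H` at a loop state. [folklore] -/
@[simp]
theorem curlNegH_loop (v : (G.curl tf (-1)).EnhancedState → R) (u : G.EnhancedState) (x : Bool) :
    G.curlNegH tf v (curlLoopES tf (-1) u x) = 0 := by
  simp [curlNegH]

/-- `H` at the `0`-smoothed curl. [folklore] -/
@[simp]
theorem curlNegH_thru (v : (G.curl tf (-1)).EnhancedState → R) (u : G.EnhancedState) :
    G.curlNegH tf v (curlThruES tf (-1) u) = -((-1) ^ u.state.weight * v (curlLoopES tf (-1) u true)) := by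
  simp [curlNegH]

variable (h t)

/-- **`B F = 1`.** [folklore] -/
theorem curlNegB_curlNegF (w : G.EnhancedState → R) : G.curlNegB tf h t (G.curlNegF tf w) = w := by
  funext u'; simp

/-- **`F` is a chain map**: `d' (F w) = F (d w)` (the `1`-labelled loop states span a
subcomplex isomorphic to `C(D)`). [folklore] -/
theorem totalD_curlNegF (w : G.EnhancedState → R) :
    (G.curl tf (-1)).totalD R h t (G.curlNegF tf w) = G.curlNegF tf (G.totalD R h t w) := by
  funext y
  rcases eq_curlLoopES_or_eq_curlThruES tf (-1) y with ⟨u, x, rfl⟩ | ⟨u, rfl⟩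
  · cases x
    · rw [totalD_curl_neg_one_loop_false, curlNegF_loop_false, totalD_apply]
      simp
    · rw [totalD_curl_neg_one_loop_true, curlNegF_loop_true]
      simp
  · rw [totalD_curl_neg_one_thru, curlNegF_thru]
    simp

/-- **`B` is a chain map**: `d (B v) = B (d' v)` — this is the chain-map property of the
`1`-component of the comultiplication at the base arc (`sum_coactCoeff_mul_incidence`); the
`thru` contributions cancel. Khovanov (2000), §5.1; Bar-Natan (2002), §4. [cite: Khovanov2000, §5.1] -/
theorem totalD_curlNegB (v : (G.curl tf (-1)).EnhancedState → R) :
    G.totalD R h t (G.curlNegB tf h t v) = G.curlNegB tf h t ((G.curl tf (-1)).totalD R h t v) := by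
  funext u'
  rw [totalD_apply, curlNegB_apply, totalD_curl_neg_one_loop_false]
  simp only [curlNegB_apply, totalD_curl_neg_one_loop_true, mul_sub, Finset.sum_sub_distrib, mul_add,
    Finset.sum_add_distrib]
  -- the `thru` terms of the right-hand side cancel
  have hthru : ∑ s, (-1) ^ s.state.weight * coactCoeff R h t G.baseArc false s u' * v (curlThruES tf (-1) s) -
      ∑ x, coactCoeff R h t G.baseArc false x u' * ((-1) ^ x.state.weight * v (curlThruES tf (-1) x)) = 0 := by
    rw [← Finset.sum_sub_distrib]
    exact Finset.sum_eq_zero fun s _ ↦ by ring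
  -- the double sums agree by the chain-map property of `Δ₁`
  have hdouble : ∑ x, G.incidence R h t x u' *
      ∑ u, coactCoeff R h t G.baseArc false u x * v (curlLoopES tf (-1) u true) =
      ∑ x, coactCoeff R h t G.baseArc false x u' *
        ∑ s, G.incidence R h t s x * v (curlLoopES tf (-1) s true) := by
    simp only [Finset.mul_sum]
    rw [Finset.sum_comm]
    conv_rhs => rw [Finset.sum_comm]
    refine Finset.sum_congr rfl fun a _ ↦ ?_
    have key := congrArg (· * v (curlLoopES tf (-1) a true)) (sum_coactCoeff_mul_incidence h t a u')
    simp only [Finset.sum_mul] at key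
    calc ∑ b, G.incidence R h t b u' * (coactCoeff R h t G.baseArc false a b * v (curlLoopES tf (-1) a true))
        = ∑ b, coactCoeff R h t G.baseArc false a b * G.incidence R h t b u' * v (curlLoopES tf (-1) a true) :=
          Finset.sum_congr rfl fun b _ ↦ by ring
      _ = ∑ b, G.incidence R h t a b * coactCoeff R h t G.baseArc false b u' * v (curlLoopES tf (-1) a true) := key
      _ = ∑ b, coactCoeff R h t G.baseArc false b u' * (G.incidence R h t a b * v (curlLoopES tf (-1) a true)) :=
          Finset.sum_congr rfl fun b _ ↦ by ring
  linear_combination -hdouble - hthru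

/-- **`F B - 1 = d' H + H d'`.** Khovanov (2000), §5.1; Bar-Natan (2002), §4. [cite: BarNatan2002, §4] -/
theorem curlNegF_curlNegB_sub (v : (G.curl tf (-1)).EnhancedState → R) :
    G.curlNegF tf (G.curlNegB tf h t v) - v =
      (G.curl tf (-1)).totalD R h t (G.curlNegH tf v) + G.curlNegH tf ((G.curl tf (-1)).totalD R h t v) := by
  funext y
  simp only [Pi.sub_apply, Pi.add_apply]
  rcases eq_curlLoopES_or_eq_curlThruES tf (-1) y with ⟨u, x, rfl⟩ | ⟨u, rfl⟩
  · cases x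
    · -- `u ⊗ 1`
      rw [curlNegF_loop_false, curlNegB_apply, totalD_curl_neg_one_loop_false, curlNegH_loop]
      simp only [curlNegH_loop, curlNegH_thru, mul_zero, Finset.sum_const_zero, zero_add, add_zero,
        sub_sub_cancel_left, mul_neg, Finset.sum_neg_distrib, neg_inj]
      refine Finset.sum_congr rfl fun s _ ↦ ?_
      have hs := negOnePow_mul_self (R := R) s.state.weight
      linear_combination (-(coactCoeff R h t G.baseArc false s u * v (curlLoopES tf (-1) s true))) * hs
    · -- `u ⊗ X`
      rw [curlNegF_loop_true, totalD_curl_neg_one_loop_true, curlNegH_loop]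
      simp only [curlNegH_loop, curlNegH_thru, mul_zero, Finset.sum_const_zero, zero_add, add_zero,
        zero_sub, mul_neg]
      have hu := negOnePow_mul_self (R := R) u.state.weight
      linear_combination (v (curlLoopES tf (-1) u true)) * hu
  · -- the `0`-smoothed curl
    rw [curlNegF_thru, totalD_curl_neg_one_thru, curlNegH_thru, totalD_curl_neg_one_loop_true]
    simp only [curlNegH_thru, zero_sub, mul_neg, Finset.sum_neg_distrib]
    have hsum : ∑ s, G.incidence R h t s u * ((-1) ^ s.state.weight * v (curlLoopES tf (-1) s true)) +
        (-1) ^ u.state.weight * ∑ s, G.incidence R h t s u * v (curlLoopES tf (-1) s true) = 0 := by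
      rw [Finset.mul_sum, ← Finset.sum_add_distrib]
      refine Finset.sum_eq_zero fun s _ ↦ ?_
      have := negOnePow_weight_mul_incidence h t s u
      linear_combination (v (curlLoopES tf (-1) s true)) * this
    have hu := negOnePow_mul_self (R := R) u.state.weight
    linear_combination hsum + (v (curlThruES tf (-1) u)) * hu

variable (G)

/-- **The homotopy data of the negative curl.** [folklore] -/
def curlNegHtpy : HtpyData R G (G.curl tf (-1)) h t where
  F := G.curlNegF tf
  B := G.curlNegB tf h t
  H := G.curlNegH tf
  F_comm := totalD_curlNegF tf h t
  B_comm := totalD_curlNegB tf h t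
  B_F := curlNegB_curlNegF tf h t
  F_B := curlNegF_curlNegB_sub tf h t

variable {G}

/-! ### Degrees -/

/-- `F` preserves the homological degree. [folklore] -/
theorem suppDeg_curlNegF (i : ℤ) (w : G.EnhancedState → R) (hw : SuppDeg i w) :
    SuppDeg i (G.curlNegF tf w) := by
  intro y hy
  rcases eq_curlLoopES_or_eq_curlThruES tf (-1) y with ⟨u, x, rfl⟩ | ⟨u, rfl⟩
  · cases x
    · rw [curlNegF_loop_false, hw u (by rw [homDegree_curlLoopES] at hy; exact hy)]
    · exact curlNegF_loop_true tf w u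
  · exact curlNegF_thru tf w u

/-- `B` preserves the homological degree. [folklore] -/
theorem suppDeg_curlNegB (i : ℤ) (v : (G.curl tf (-1)).EnhancedState → R) (hv : SuppDeg i v) :
    SuppDeg i (G.curlNegB tf h t v) := by
  intro u' hu'
  rw [curlNegB_apply, hv _ (by rw [homDegree_curlLoopES]; exact hu'), zero_sub, neg_eq_zero]
  refine Finset.sum_eq_zero fun u _ ↦ ?_
  by_cases h0 : coactCoeff R h t G.baseArc false u u' = 0
  · rw [h0, zero_mul]
  · rw [hv _ (fun hu ↦ hu' ?_), mul_zero]
    rw [homDegree_curlLoopES, homDegree, ← state_eq_of_coactCoeff_ne_zero R h0] at hu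
    exact hu

/-- `H` lowers the homological degree by one. [folklore] -/
theorem suppDeg_curlNegH (i : ℤ) (v : (G.curl tf (-1)).EnhancedState → R) (hv : SuppDeg i v) :
    SuppDeg (i - 1) (G.curlNegH tf v) := by
  intro y hy
  rcases eq_curlLoopES_or_eq_curlThruES tf (-1) y with ⟨u, x, rfl⟩ | ⟨u, rfl⟩
  · exact curlNegH_loop tf v u x
  · rw [curlNegH_thru, hv _ (fun h' ↦ hy ?_), mul_zero, neg_zero]
    rw [homDegree_curlThruES]
    rw [homDegree_curlLoopES] at h'
    push_cast
    linarith

/-- **Khovanov homology over the universal Frobenius system is invariant under a negative curl**,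
for every Gauss diagram and every `(R, h, t)`. Khovanov (2000), §5.1, Thm. 1; Khovanov (2006),
Prop. 6; Bar-Natan (2002), §4. [cite: Khovanov2000, §5.1] -/
theorem nonempty_iso_frobeniusHomology_curl_neg_one (i : ℤ) :
    Nonempty (G.frobeniusHomology R h t i ≅ (G.curl tf (-1)).frobeniusHomology R h t i) :=
  (G.curlNegHtpy tf h t).nonempty_iso_frobeniusHomology (suppDeg_curlNegF tf)
    (suppDeg_curlNegB tf h t) (suppDeg_curlNegH tf) i

/-! ### Bidegrees (integral theory, `h = t = 0`) -/

/-- At `h = t = 0`, the `1`-component of `Δ` at the base arc is multiplication by `X` there, so a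
nonzero coefficient lowers the quantum degree by `2`. [folklore] -/
theorem qDegree_eq_of_coactCoeff_false_ne_zero {α : G.Arc} {s u : G.EnhancedState}
    (h0 : coactCoeff ℤ 0 0 α false s u ≠ 0) : qDegree u = qDegree s - 2 := by
  rw [coactCoeff_false] at h0
  simp only [ite_self, sub_zero] at h0
  exact qDegree_eq_of_actCoeff_ne_zero h0

/-- `F` has bidegree `(0, 0)`. [folklore] -/
theorem suppBideg_curlNegF (i j : ℤ) (w : G.EnhancedState → ℤ) (hw : SuppBideg i j w) :
    SuppBideg i j (G.curlNegF tf w) := by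
  intro y hy
  rcases eq_curlLoopES_or_eq_curlThruES tf (-1) y with ⟨u, x, rfl⟩ | ⟨u, rfl⟩
  · cases x
    · rw [curlNegF_loop_false, hw u (fun hu ↦ hy ⟨?_, ?_⟩)]
      · rw [homDegree_curlLoopES]; exact hu.1
      · rw [qDegree_curlLoopES, hu.2, labelDeg_false]; push_cast; ring
    · exact curlNegF_loop_true tf w u
  · exact curlNegF_thru tf w u

/-- `B` has bidegree `(0, 0)` at `h = t = 0`. [folklore] -/
theorem suppBideg_curlNegB (i j : ℤ) (v : (G.curl tf (-1)).EnhancedState → ℤ) (hv : SuppBideg i j v) :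
    SuppBideg i j (G.curlNegB tf 0 0 v) := by
  intro u' hu'
  rw [curlNegB_apply, hv _ (fun h' ↦ hu' ?_), zero_sub, neg_eq_zero]
  · refine Finset.sum_eq_zero fun u _ ↦ ?_
    by_cases h0 : coactCoeff ℤ 0 0 G.baseArc false u u' = 0
    · rw [h0, zero_mul]
    · rw [hv _ (fun hu ↦ hu' ⟨?_, ?_⟩), mul_zero]
      · rw [homDegree_curlLoopES, homDegree, ← state_eq_of_coactCoeff_ne_zero ℤ h0] at hu
        exact hu.1
      · rw [qDegree_curlLoopES, labelDeg_true] at hu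
        rw [qDegree_eq_of_coactCoeff_false_ne_zero h0]
        push_cast at hu
        linarith [hu.2]
  · rw [homDegree_curlLoopES, qDegree_curlLoopES, labelDeg_false] at h'
    push_cast at h'
    exact ⟨h'.1, by linarith [h'.2]⟩

/-- `H` has bidegree `(-1, 0)`. [folklore] -/
theorem suppBideg_curlNegH (i j : ℤ) (v : (G.curl tf (-1)).EnhancedState → ℤ) (hv : SuppBideg i j v) :
    SuppBideg (i - 1) j (G.curlNegH tf v) := by
  intro y hy
  rcases eq_curlLoopES_or_eq_curlThruES tf (-1) y with ⟨u, x, rfl⟩ | ⟨u, rfl⟩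
  · exact curlNegH_loop tf v u x
  · rw [curlNegH_thru, hv _ (fun h' ↦ hy ?_), mul_zero, neg_zero]
    rw [homDegree_curlThruES, qDegree_curlThruES]
    rw [homDegree_curlLoopES, qDegree_curlLoopES, labelDeg_true] at h'
    push_cast at h' ⊢
    exact ⟨by linarith [h'.1], by linarith [h'.2]⟩

/-- **Integral Khovanov homology is invariant under a negative curl, in every bidegree and for
every Gauss diagram**: `Kh^{i,j}(G) ≅ Kh^{i,j}(G.curl tf (-1))`. Khovanov (2000), §5.1 and Thm. 1;
Bar-Natan (2002), §4, Thm. 1. [cite: Khovanov2000, Thm. 1] -/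
theorem nonempty_iso_khovanovHomology_curl_neg_one (i j : ℤ) :
    Nonempty (G.khovanovHomology i j ≅ (G.curl tf (-1)).khovanovHomology i j) :=
  (G.curlNegHtpy tf 0 0).nonempty_iso_khovanovHomology (suppBideg_curlNegF tf)
    (suppBideg_curlNegB tf) (suppBideg_curlNegH tf) i j

end Neg

/-! ## Both signs -/

/-- **Khovanov homology over the universal Frobenius system is invariant under the curl at the
last position, for both signs, both orientations of entry, every Gauss diagram and every
`(R, h, t)`.** Khovanov (2000), §5.1–5.2; Bar-Natan (2002), §4. [cite: Khovanov2000, §5.1] -/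
theorem nonempty_iso_frobeniusHomology_curl (ε : ℤˣ) (h t : R) (i : ℤ) :
    Nonempty (G.frobeniusHomology R h t i ≅ (G.curl tf ε).frobeniusHomology R h t i) := by
  rcases Int.units_eq_one_or ε with rfl | rfl
  · exact nonempty_iso_frobeniusHomology_curl_one tf h t i
  · exact nonempty_iso_frobeniusHomology_curl_neg_one tf h t i

/-- **Integral Khovanov homology is invariant under the curl at the last position, for both signs,
both orientations of entry and every Gauss diagram**: `Kh^{i,j}(G) ≅ Kh^{i,j}(G.curl tf ε)` — the
first Reidemeister move at the last position, with no realisability hypothesis.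
Khovanov (2000), §5.1–5.2, Thm. 1; Bar-Natan (2002), §4, Thm. 1. [cite: Khovanov2000, Thm. 1] -/
theorem nonempty_iso_khovanovHomology_curl (ε : ℤˣ) (i j : ℤ) :
    Nonempty (G.khovanovHomology i j ≅ (G.curl tf ε).khovanovHomology i j) := by
  rcases Int.units_eq_one_or ε with rfl | rfl
  · exact nonempty_iso_khovanovHomology_curl_one tf i j
  · exact nonempty_iso_khovanovHomology_curl_neg_one tf i j

end GaussDiagram

end Literature.Topology.FourManifolds
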